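import Mathlib
import Summits.HodgeConjecture.FermatCycles.HodgeFermatThreePointwiseB
import Summits.HodgeConjecture.FermatCycles.HodgeFermatDescent
import Summits.HodgeConjecture.FermatCycles.HodgeFermatTheoremZ3UB

/-!
# The row p = 3 of THEOREM L, step 3: FORCED SHARING — the (Z3, Z1) coincidences at 3 classified (`HodgeFermat/ThreeShared.lean`; HF-G30b)

Tree copy (whole module) of the module `HodgeFermat/ThreeShared.lean` of the sibling cell's standalone package
`run/shared/lean/pub/pub-hodgefermat/lean/HodgeFermat/` (206 lines, sha256 `b1ea6d8f42d381c0…`), source lines 22–206 (all: `exists_mid`, the identity (L2) `sameType_L2`, FORCED SHARING `z3z1_three`, `three_shared`, `three_shared_level`).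
Filed by cell `pub-hfermat`, seat prover-1 gen-3, on the COORDINATOR KEEPER RULING of 2026-08-25 (gem sweep H1: take the
off-gate kernel theorem `thmFstar` through the gate) — here THEOREM F* of `tables/DPRIME-THEOREM.md` §9 IN FULL, i.e.
PROPOSITION D′(3N) and the descent (`HodgeFermat/PropDPrimeNFinal.lean`, GATE HF-G34), the last off-gate form of THEOREM F*
(its first two forms, `DecodingFinal.thmFstar` = F* at the prime levels and `ThmFstarNFinal.thmFstar` = F*(3N), landed on
2026-08-25 as `HodgeFermatThmFstar.lean` / `HodgeFermatThmFstarN.lean`, seats prover-1 gen-0 / gen-2); this file is one link of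
the import closure of `PropDPrimeNFinal.propDprime` (the sibling's KR-free chain: THEOREM L, COROLLARY M, THEOREM D6,
THEOREM U⁺, THEOREM KR6, THEOREM Z3U) on top of those landed chains.  The source module is the sibling's hub-checked module of
record (pub-hodgefermat `CERT.md` l.960, GATE HF-G30b; cell record `check/ThreeShared_standalone.lean` sha256 `dc6e1b8387983bc0…`); its declarations are copied VERBATIM.
Deviations from the source module, exhaustively: the `import` lines (tree modules `Summits.HodgeConjecture.FermatCycles.
HodgeFermat*` instead of `HodgeFermat.*`); this module docstring; the source's `open HodgeFermat.KRFree.Descent (sameType_descend)` (l.30) becomes `open HodgeFermat.KRFree.TheoremL (sameType_descend)`: the restated `Descent.sameType_descend` was deleted in `HodgeFermatDescent.lean` in favour of the identical `TheoremL.sameType_descend` of `HodgeFermatPropL7aB.lean`.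
Every other line — in particular every declaration's statement and proof — is byte-identical to the source.
HONEST FRAMING: explicit algebraic cycles for specific Hodge classes on Fermat/Delsarte varieties; residual open instances
listed; no claim on general Hodge.  (This file is arithmetic of CM types / finite combinatorics / analytic number theory
of the sibling's KR-free programme; it claims nothing about cycles.)

The source module's docstring (ThreeShared.lean l.5–20), verbatim:

## KR-FREE PROGRAMME — the row p = 3 of THEOREM L, step 3: FORCED SHARING (the (Z3, Z1) coincidences at 3 classified)

Level `m = 3n`, `n` squarefree, odd, `3 ∤ n`.  If a Z3-at-3 triple `T = (3a, 3b, 3c)` and a Z1-at-3 triple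
`T' = (3y, x₂, x₃)` (zero sums, no entry `≡ 0 (mod m)`, `3 ∤ x₂x₃`) have the same CM type, then
`x₂ ≡ x₃ (mod n)` and `{a, b, c} ≡ {y, x₂, h} (mod n)` with `2h ≡ y` [`z3z1_three`, under THEOREM KR6 `KR6'`];
in particular `T` and `T'` SHARE the entry `3y` modulo `m` [`three_shared`, `three_shared_level`].  Unlike the row p = 5
(`FiveZ3Z1.z3z1_five`: empty), this row is realised — `(3, 3, 9) ∼ (3, 1, 11)` at `m = 15` — by exactly such shared
pairs (`2(n − 1)` ordered ones per level: `results/gen30/local/z3z1_three_scan_393.txt`).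
Steps: `ThreeFibre.mid_iff` (fibre-constancy = LEMMA N at p = 3) ⟹ `ThreePointwise.pointwise₃` (LEMMA P3) ⟹
`x₂ ≡ x₃ (mod n)` ⟹ the explicit identity `sameType_L2` (`(3y, x₂, ·) ∼ (3y, 3x₂, ·)` at `3n` whenever `n ∣ 3y + 2x₂`:
the distribution relation at 3 in CM-type form) ⟹ `Descent.sameType_descend` (divide by 3) ⟹ THEOREM KR6 at the level `n`.

Generation 30 (HF-G30b) of the hodge-fermat build.  LIGHT module (imports `ThreePointwise`, `Descent`, `TheoremZ3U`).
No `sorry`, no `decide`, no axiom beyond [propext, Classical.choice, Quot.sound].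
-/

set_option autoImplicit false

namespace HodgeFermat.KRFree.ThreeShared

open HodgeFermat.KRFree.LemmaN HodgeFermat.KRFree.TheoremL HodgeFermat.KRFree.LemmaO
open HodgeFermat.KRFree.ThreeFibre HodgeFermat.KRFree.ThreePointwise
open HodgeFermat.KRFree.TheoremUEq (Perm3)
open HodgeFermat.KRFree.TheoremZ3U (KR6')
open HodgeFermat.KRFree.TheoremL (sameType_descend)

/-- a residue `z ≢ 0 (mod n)` is moved into the middle third by some unit (LEMMA O: `2⟨u z⟩_n = n − gcd(z, n)` and
`3 gcd(z, n) < n`). -/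
lemma exists_mid (n z : ℕ) (hn : 0 < n) (hodd : Odd n) (h3n : ¬ 3 ∣ n) (hz : ¬ n ∣ z) :
    ∃ u, Nat.Coprime u n ∧ Mid n (u * z % n) := by
  obtain ⟨u, hu, h2v⟩ := lemmaO_half_sub n z hn hodd hz
  have h3g := three_gcd_le n z hn hodd hz
  refine ⟨u, hu, ?_⟩
  obtain ⟨g, hg⟩ : ∃ g, Nat.gcd z n = g := ⟨_, rfl⟩
  rw [hg] at h2v h3g
  have h3g' : 3 * g ≠ n := by
    rintro rfl
    exact h3n (dvd_mul_right 3 g)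
  unfold Mid
  omega

/-- **the identity (L2)** — the distribution relation at 3 in CM-type form: if `n ∣ 3y + 2x₂` (`3 ∤ x₂`, `3 ∤ n`) then
`(3y, x₂, ·)` and `(3y, 3x₂, ·)` have the same CM type at the level `3n` (the type involves the first two entries only). -/
theorem sameType_L2 (n y x₂ x₃ w : ℕ) (h3n : ¬ 3 ∣ n) (hn : 0 < n) (hx₂ : ¬ 3 ∣ x₂)
    (hrel : n ∣ 3 * y + 2 * x₂) :
    SameType (3 * n) (3 * y, x₂, x₃) (3 * y, 3 * x₂, w) := by
  intro t ht
  show t * (3 * y) % (3 * n) + t * x₂ % (3 * n) < 3 * n ↔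
    t * (3 * y) % (3 * n) + t * (3 * x₂) % (3 * n) < 3 * n
  have e1 : t * (3 * y) % (3 * n) = 3 * (t * y % n) := by
    rw [show t * (3 * y) = 3 * (t * y) by ring, Nat.mul_mod_mul_left]
  have e2 : t * (3 * x₂) % (3 * n) = 3 * (t * x₂ % n) := by
    rw [show t * (3 * x₂) = 3 * (t * x₂) by ring, Nat.mul_mod_mul_left]
  rw [e1, e2]
  -- R = ⟨t x₂⟩_{3n} = n k + ρ with 3 ∤ R
  have hRρ : t * x₂ % (3 * n) % n = t * x₂ % n := Nat.mod_mul_left_mod _ 3 n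
  have hR := Nat.div_add_mod (t * x₂ % (3 * n)) n
  rw [hRρ] at hR
  have ht3 : ¬ 3 ∣ t := by
    have h33 : Nat.Coprime t 3 := Nat.Coprime.coprime_dvd_right (dvd_mul_right 3 n) ht
    exact (Nat.Prime.coprime_iff_not_dvd Nat.prime_three).mp h33.symm
  have hR3 : (t * x₂ % (3 * n)) % 3 ≠ 0 := by
    rw [Nat.mod_mod_of_dvd _ (dvd_mul_right 3 n)]
    intro h
    rcases (Nat.Prime.dvd_mul Nat.prime_three).mp (Nat.dvd_of_mod_eq_zero h) with h4 | h4
    · exact ht3 h4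
    · exact hx₂ h4
  have hn3 : n % 3 ≠ 0 := fun h => h3n (Nat.dvd_of_mod_eq_zero h)
  have hRlt : t * x₂ % (3 * n) < 3 * n := Nat.mod_lt _ (by omega)
  -- n ∣ 3A + 2ρ
  have hAρ : n ∣ 3 * (t * y % n) + 2 * (t * x₂ % n) := by
    have h1 := (Nat.mod_modEq (t * y) n).mul_left 3
    have h2 := (Nat.mod_modEq (t * x₂) n).mul_left 2
    have h3 := h1.add h2
    have h4 : 3 * (t * y) + 2 * (t * x₂) = t * (3 * y + 2 * x₂) := by ring
    rw [h4] at h3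
    exact Nat.modEq_zero_iff_dvd.mp (h3.trans (Nat.modEq_zero_iff_dvd.mpr (Dvd.dvd.mul_left hrel t)))
  obtain ⟨A, hA⟩ : ∃ s, t * y % n = s := ⟨_, rfl⟩
  obtain ⟨ρ, hρ⟩ : ∃ s, t * x₂ % n = s := ⟨_, rfl⟩
  obtain ⟨R, hRe⟩ : ∃ s, t * x₂ % (3 * n) = s := ⟨_, rfl⟩
  have hAn : A < n := by rw [← hA]; exact Nat.mod_lt _ hn
  have hρn : ρ < n := by rw [← hρ]; exact Nat.mod_lt _ hn
  rw [hA, hρ] at hAρ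
  rw [hρ, hRe] at hR
  rw [hRe] at hR3 hRlt
  rw [hA, hRe]
  obtain ⟨k, hk⟩ : ∃ s, R / n = s := ⟨_, rfl⟩
  rw [hk] at hR
  have hk3 : k < 3 := by rw [← hk]; exact (Nat.div_lt_iff_lt_mul hn).mpr (by omega)
  obtain ⟨i, hi⟩ := hAρ
  have hi5 : i < 5 := by
    have : n * i < n * 5 := by rw [← hi]; omega
    exact Nat.lt_of_mul_lt_mul_left this
  interval_cases k <;> interval_cases i <;> omega

/-- **THEOREM (the row p = 3 of THEOREM L classified).**  `n` squarefree, odd, `3 ∤ n`; `T = (3a, 3b, 3c)` and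
`T' = (3y, x₂, x₃)` zero-sum triples of level `3n` with no entry `≡ 0 (mod 3n)`, `3 ∤ x₂ x₃`, of the same CM type.  Then,
under THEOREM KR6: `x₂ ≡ x₃ (mod n)` and `(a, b, c)` is a permutation of `(y, x₂, h)` modulo `n`, `h = (n+1)/2 · y`
(`2h ≡ y`, `x₂ ≡ x₃ ≡ −3h (mod n)`). -/
theorem z3z1_three (hKR : KR6') (n a b c y x₂ x₃ : ℕ) (hsq : Squarefree n) (hodd : Odd n) (h3n : ¬ 3 ∣ n)
    (hsT : n ∣ a + b + c) (ha : ¬ n ∣ a) (hb : ¬ n ∣ b) (hc : ¬ n ∣ c)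
    (hs : 3 * n ∣ 3 * y + x₂ + x₃) (hx₂ : ¬ 3 ∣ x₂) (hx₃ : ¬ 3 ∣ x₃) (hy : ¬ n ∣ y)
    (hH : SameType (3 * n) (3 * a, 3 * b, 3 * c) (3 * y, x₂, x₃)) :
    x₂ ≡ x₃ [MOD n] ∧ Perm3 (a % n) (b % n) (c % n) (y % n) (x₂ % n) ((n + 1) / 2 * y % n) := by
  have hn : 0 < n := hodd.pos
  have h2 : ¬ 2 ∣ n := by obtain ⟨k, hk⟩ := hodd; omega
  have h2co : Nat.Coprime 2 n := Nat.coprime_two_left.mpr hodd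
  have h3co : Nat.Coprime 3 n := (Nat.Prime.coprime_iff_not_dvd Nat.prime_three).mpr h3n
  have cop2 : ∀ z, n ∣ 2 * z → n ∣ z := fun z h => Nat.Coprime.dvd_of_dvd_mul_left h2co.symm h
  have cop3 : ∀ z, n ∣ 3 * z → n ∣ z := fun z h => Nat.Coprime.dvd_of_dvd_mul_left h3co.symm h
  have hsn : n ∣ 3 * y + x₂ + x₃ := dvd_of_level hs
  have h3y : ¬ n ∣ 3 * y := fun h => hy (cop3 y h)
  -- (FC) fibre-constancy, from LEMMA N at p = 3
  have hM : ∀ t, Nat.Coprime t n → (Mid n (t * x₂ % n) ↔ Mid n (t * x₃ % n)) :=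
    fun t ht => mid_iff n a b c y x₂ x₃ t h3n hn hs hx₂ hx₃ hH ht
  -- no entry of T' is ≡ 0 (mod n)
  have aux : ∀ u v, n ∣ 3 * y + u + v → (∀ t, Nat.Coprime t n → (Mid n (t * u % n) ↔ Mid n (t * v % n))) →
      ¬ n ∣ u := by
    intro u v huv hM' hu
    have hv : ¬ n ∣ v := fun hv =>
      h3y ((Nat.dvd_add_right (dvd_add hu hv)).mp (by rwa [show 3 * y + u + v = u + v + 3 * y by ring] at huv))
    obtain ⟨t, ht, hmid⟩ := exists_mid n v hn hodd h3n hv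
    have h0 : t * u % n = 0 := Nat.mod_eq_zero_of_dvd (Dvd.dvd.mul_left hu t)
    have hm := (hM' t ht).mpr hmid
    rw [h0] at hm
    unfold Mid at hm
    omega
  have hx₂n : ¬ n ∣ x₂ := aux x₂ x₃ hsn hM
  have hx₃n : ¬ n ∣ x₃ :=
    aux x₃ x₂ (by rwa [Nat.add_right_comm] at hsn) (fun t ht => (hM t ht).symm)
  -- LEMMA P3
  have hx : x₂ ≡ x₃ [MOD n] := by
    rcases pointwise₃ n x₂ x₃ hsq hodd h3n hx₂n hx₃n hM with h | h
    · exact h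
    · exact absurd ((Nat.dvd_add_right h).mp (by rwa [show 3 * y + x₂ + x₃ = x₂ + x₃ + 3 * y by ring] at hsn)) h3y
  refine ⟨hx, ?_⟩
  -- h = (n+1)/2 · y
  obtain ⟨H, hHdef⟩ : ∃ H, (n + 1) / 2 = H := ⟨_, rfl⟩
  rw [hHdef]
  have hH2 : 2 * H = n + 1 := by obtain ⟨k, hk⟩ := hodd; omega
  have hh2 : 2 * (H * y) = n * y + y := by
    rw [← mul_assoc, hH2]; ring
  -- the relations n ∣ 3y + 2x₂, n ∣ x₂ + 3h, n ∣ y + x₂ + h, ¬ n ∣ h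
  have hr1 : n ∣ 3 * y + 2 * x₂ := by
    have e : 3 * y + x₂ + x₃ ≡ 3 * y + 2 * x₂ [MOD n] := by
      rw [show 3 * y + 2 * x₂ = 3 * y + x₂ + x₂ by ring]
      exact Nat.ModEq.add_left _ hx.symm
    exact Nat.modEq_zero_iff_dvd.mp (e.symm.trans (Nat.modEq_zero_iff_dvd.mpr hsn))
  have hr2 : n ∣ x₂ + 3 * (H * y) := by
    apply cop2
    have e : 2 * (x₂ + 3 * (H * y)) = (3 * y + 2 * x₂) + 3 * (n * y) := by omega
    rw [e]
    exact dvd_add hr1 (Dvd.dvd.mul_left (dvd_mul_right n y) 3)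
  have hr3 : n ∣ y + x₂ + H * y := by
    apply cop2
    have e : 2 * (y + x₂ + H * y) = (3 * y + 2 * x₂) + n * y := by omega
    rw [e]
    exact dvd_add hr1 (dvd_mul_right n y)
  have hh0 : ¬ n ∣ H * y := by
    intro h
    have h1 : n ∣ n * y + y := hh2 ▸ Dvd.dvd.mul_left h 2
    exact hy ((Nat.dvd_add_right (dvd_mul_right n y)).mp h1)
  -- (L2), transitivity, descent to the level n
  have hL2 : SameType (3 * n) (3 * y, x₂, x₃) (3 * y, 3 * x₂, 3 * (H * y)) :=
    sameType_L2 n y x₂ x₃ (3 * (H * y)) h3n hn hx₂ hr1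
  have hT : SameType (3 * n) (3 * a, 3 * b, 3 * c) (3 * y, 3 * x₂, 3 * (H * y)) :=
    fun t ht => (hH t ht).trans (hL2 t ht)
  have hd : SameType n (a, b, c) (y, x₂, H * y) := sameType_descend (by norm_num) hn hT
  -- THEOREM KR6 at the level n
  exact hKR n a b c y x₂ (H * y) hsq h2 h3n hsT hr3 ha hb hc hy hx₂n hh0 hd

/-- **FORCED SHARING.**  In the situation of `z3z1_three`: `y ≡ a`, `b` or `c (mod n)` — the Z1-entry `3y` of `T'`
is congruent modulo `m = 3n` to an entry of `T`. -/
theorem three_shared (hKR : KR6') (n a b c y x₂ x₃ : ℕ) (hsq : Squarefree n) (hodd : Odd n) (h3n : ¬ 3 ∣ n)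
    (hsT : n ∣ a + b + c) (ha : ¬ n ∣ a) (hb : ¬ n ∣ b) (hc : ¬ n ∣ c)
    (hs : 3 * n ∣ 3 * y + x₂ + x₃) (hx₂ : ¬ 3 ∣ x₂) (hx₃ : ¬ 3 ∣ x₃) (hy : ¬ n ∣ y)
    (hH : SameType (3 * n) (3 * a, 3 * b, 3 * c) (3 * y, x₂, x₃)) :
    y ≡ a [MOD n] ∨ y ≡ b [MOD n] ∨ y ≡ c [MOD n] := by
  obtain ⟨-, hP⟩ := z3z1_three hKR n a b c y x₂ x₃ hsq hodd h3n hsT ha hb hc hs hx₂ hx₃ hy hH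
  unfold Perm3 at hP
  unfold Nat.ModEq
  rcases hP with h | h | h | h | h | h
  · exact Or.inl h.1.symm
  · exact Or.inl h.1.symm
  · exact Or.inr (Or.inl h.2.1.symm)
  · exact Or.inr (Or.inr h.2.2.symm)
  · exact Or.inr (Or.inl h.2.1.symm)
  · exact Or.inr (Or.inr h.2.2.symm)

/-- forced sharing at the level `m = 3n`: `3y ≡ 3a`, `3b` or `3c (mod 3n)`. -/
theorem three_shared_level (hKR : KR6') (n a b c y x₂ x₃ : ℕ) (hsq : Squarefree n) (hodd : Odd n) (h3n : ¬ 3 ∣ n)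
    (hsT : n ∣ a + b + c) (ha : ¬ n ∣ a) (hb : ¬ n ∣ b) (hc : ¬ n ∣ c)
    (hs : 3 * n ∣ 3 * y + x₂ + x₃) (hx₂ : ¬ 3 ∣ x₂) (hx₃ : ¬ 3 ∣ x₃) (hy : ¬ n ∣ y)
    (hH : SameType (3 * n) (3 * a, 3 * b, 3 * c) (3 * y, x₂, x₃)) :
    3 * y ≡ 3 * a [MOD 3 * n] ∨ 3 * y ≡ 3 * b [MOD 3 * n] ∨ 3 * y ≡ 3 * c [MOD 3 * n] := by
  rcases three_shared hKR n a b c y x₂ x₃ hsq hodd h3n hsT ha hb hc hs hx₂ hx₃ hy hH with h | h | h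
  · exact Or.inl (Nat.ModEq.mul_left' 3 h)
  · exact Or.inr (Or.inl (Nat.ModEq.mul_left' 3 h))
  · exact Or.inr (Or.inr (Nat.ModEq.mul_left' 3 h))

end HodgeFermat.KRFree.ThreeShared
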